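import Literature.Probability.Percolation.RSW
import Literature.Probability.Percolation.BondPercolationSymmetry
import Literature.Probability.LatticeModels.ThermodynamicLimit
import HarnessLib

/-!
# Crux `PercNonProliferation.FreeBoxPowerSaving` (stmt-CriticalPhenomena-4447), line `Sketch`
# (card `l2-gluing-defect-rg`) — stub `stub_subBoxesSuperadditive`

Helper file for the checked skeleton of the crux `FreeBoxPowerSaving` (route
`PercNonProliferation`), line `Sketch`.  Proves exactly the registered stub signature
`stub_subBoxesSuperadditive` (the `CROSS ≥ 0` half of the block identity of the free-box pair
sum); lands with `--supports stmt-CriticalPhenomena-4447`.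

## The statement

Bond percolation `P_p` on `ℤ³`, `B(n) = box 3 n = [-n, n]³`, free-box pair sum
`S_p(n) = Σ_{x, y ∈ B(n)} P_p(x ↔ y inside B(n))`.  The big box `B(3n+1) = [-3n-1, 3n+1]³` is the
disjoint union of the 27 translates `c_v + B(n)`, `c_v = (2n+1)(v - 1)` coordinatewise,
`v ∈ {0, 1, 2}³` (coordinate ranges `[-3n-1, -n-1]`, `[-n, n]`, `[n+1, 3n+1]`).  For every `p`, `n`:

`Σ_v Σ_{x, y ∈ B(n)} P_p(x + c_v ↔ y + c_v inside c_v + B(n)) ≤ S_p(3n+1)`.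

## The argument (Finset bookkeeping + one monotonicity, every `p`)

1. `c_v + B(n) ⊆ B(3n+1)` (`add_offset_mem_box`), so termwise
   `{x + c_v ↔ y + c_v in c_v + B(n)} ⊆ {x + c_v ↔ y + c_v in B(3n+1)}` (`openConnIn_mono`,
   `measureReal_mono`).
2. With `F(a, b) = P_p(a ↔ b in B(3n+1)) ≥ 0`: for fixed `a`, `y ↦ y + c_v` is injective from `B(n)`
   into `B(3n+1)`, so `Σ_{y ∈ B(n)} F(a, y + c_v) ≤ Σ_{b ∈ B(3n+1)} F(a, b)`
   (`sum_comp_le_of_injOn`: `Finset.sum_image` + `Finset.sum_le_sum_of_subset_of_nonneg`).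
3. `(v, x) ↦ x + c_v` is injective on `{0,1,2}³ × B(n)` into `B(3n+1)` (`add_offset_injOn`:
   coordinatewise `(2n+1)(v_i - v'_i) = x'_i - x_i ∈ [-2n, 2n]` forces `v_i = v'_i`), so the
   remaining double sum of the non-negative `G(a) = Σ_b F(a, b)` is again a sub-sum
   (`Finset.sum_product`, `sum_comp_le_of_injOn`).

The bookkeeping is done once for an arbitrary finite measure and an arbitrary finite family of
offsets (`sum_translates_le`); the stub is its specialisation to `P_p` and `c_v`.
No new definitions.
-/

noncomputable section

open MeasureTheory
open Literature.Probability.Percolation Literature.Probability.LatticeModels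
open scoped BigOperators

namespace Summit.CriticalPhenomena.PercolationContinuityZ3.FreeBoxPowerSavingLine

namespace SubBoxesSuperadditive

/-- A non-negative function summed along a map `g` that is injective on `s` and maps `s` into `t`
is at most its sum over `t` (`Finset.sum_image` + `Finset.sum_le_sum_of_subset_of_nonneg`). [folklore] -/
theorem sum_comp_le_of_injOn {α β : Type*} (s : Finset α) (t : Finset β) (g : α → β) (G : β → ℝ)
    (hG : ∀ b ∈ t, 0 ≤ G b) (hmem : ∀ a ∈ s, g a ∈ t) (hinj : Set.InjOn g ↑s) :
    ∑ a ∈ s, G (g a) ≤ ∑ b ∈ t, G b := by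
  classical
  calc ∑ a ∈ s, G (g a) = ∑ b ∈ s.image g, G b := (Finset.sum_image hinj).symm
    _ ≤ ∑ b ∈ t, G b :=
        Finset.sum_le_sum_of_subset_of_nonneg
          (fun b hb => by
            obtain ⟨a, ha, rfl⟩ := Finset.mem_image.1 hb
            exact hmem a ha)
          fun b hb _ => hG b hb

/-- **Sub-box pair sums are a sub-sum of the big-box pair sum (abstract form).**  For a finite
measure `μ` on bond configurations of `ℤ³` and a finite family of offsets `c_v` such that every
translate `c_v + B(m)` lies in `B(N)` and `(v, x) ↦ x + c_v` is injective on `univ × B(m)`: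
`Σ_v Σ_{x, y ∈ B(m)} μ(x + c_v ↔ y + c_v in c_v + B(m)) ≤ Σ_{a, b ∈ B(N)} μ(a ↔ b in B(N))`
(monotonicity of `{· ↔ · in S}` in `S`, Grimmett 1999, §1.6, then drop the cross pairs). [folklore] -/
theorem sum_translates_le (μ : Measure (BondConfig (Site 3))) [IsFiniteMeasure μ]
    {ι : Type*} [Fintype ι] {m N : ℕ} (c : ι → Site 3)
    (hmem : ∀ v, ∀ x ∈ box 3 m, x + c v ∈ box 3 N)
    (hinj : Set.InjOn (fun q : ι × Site 3 => q.2 + c q.1)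
      (↑((Finset.univ : Finset ι) ×ˢ box 3 m) : Set (ι × Site 3))) :
    ∑ v, ∑ x ∈ box 3 m, ∑ y ∈ box 3 m,
        μ.real (openConnIn ((fun w : Site 3 => w + c v) '' (↑(box 3 m) : Set (Site 3)))
          (x + c v) (y + c v)) ≤
      ∑ x ∈ box 3 N, ∑ y ∈ box 3 N, μ.real (openConnIn (↑(box 3 N) : Set (Site 3)) x y) := by
  have himg : ∀ v, (fun w : Site 3 => w + c v) '' (↑(box 3 m) : Set (Site 3)) ⊆ ↑(box 3 N) := by
    rintro v _ ⟨w, hw, rfl⟩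
    exact Finset.mem_coe.2 (hmem v w (Finset.mem_coe.1 hw))
  calc ∑ v, ∑ x ∈ box 3 m, ∑ y ∈ box 3 m,
          μ.real (openConnIn ((fun w : Site 3 => w + c v) '' (↑(box 3 m) : Set (Site 3)))
            (x + c v) (y + c v))
      ≤ ∑ v, ∑ x ∈ box 3 m, ∑ y ∈ box 3 m,
          μ.real (openConnIn (↑(box 3 N) : Set (Site 3)) (x + c v) (y + c v)) := by
        refine Finset.sum_le_sum fun v _ => Finset.sum_le_sum fun x _ =>
          Finset.sum_le_sum fun y _ => ?_
        exact measureReal_mono (openConnIn_mono (himg v) _ _) (measure_ne_top _ _)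
    _ ≤ ∑ v, ∑ x ∈ box 3 m, ∑ b ∈ box 3 N,
          μ.real (openConnIn (↑(box 3 N) : Set (Site 3)) (x + c v) b) := by
        refine Finset.sum_le_sum fun v _ => Finset.sum_le_sum fun x _ => ?_
        exact sum_comp_le_of_injOn (box 3 m) (box 3 N) (fun y => y + c v)
          (fun b => μ.real (openConnIn (↑(box 3 N) : Set (Site 3)) (x + c v) b))
          (fun _ _ => measureReal_nonneg) (hmem v) (fun y _ y' _ h => add_right_cancel h)
    _ = ∑ q ∈ (Finset.univ : Finset ι) ×ˢ box 3 m, ∑ b ∈ box 3 N,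
          μ.real (openConnIn (↑(box 3 N) : Set (Site 3)) (q.2 + c q.1) b) := by
        rw [Finset.sum_product]
    _ ≤ ∑ a ∈ box 3 N, ∑ b ∈ box 3 N, μ.real (openConnIn (↑(box 3 N) : Set (Site 3)) a b) :=
        sum_comp_le_of_injOn ((Finset.univ : Finset ι) ×ˢ box 3 m) (box 3 N) (fun q => q.2 + c q.1)
          (fun a => ∑ b ∈ box 3 N, μ.real (openConnIn (↑(box 3 N) : Set (Site 3)) a b))
          (fun _ _ => Finset.sum_nonneg fun _ _ => measureReal_nonneg)
          (fun q hq => hmem q.1 q.2 (Finset.mem_product.1 hq).2) hinj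

/-- The sub-box offsets `(2n+1)(t - 1)`, `t ∈ {0, 1, 2}`, lie in `[-(2n+1), 2n+1]`. [folklore] -/
theorem offset_bounds (n : ℕ) (t : ℤ) (ht0 : 0 ≤ t) (ht2 : t ≤ 2) :
    -(2 * (n : ℤ) + 1) ≤ (2 * (n : ℤ) + 1) * (t - 1) ∧
      (2 * (n : ℤ) + 1) * (t - 1) ≤ 2 * (n : ℤ) + 1 := by
  interval_cases t <;> omega

/-- Coordinatewise injectivity of `(t, a) ↦ a + (2n+1)(t - 1)` on `{0, 1, 2} × [-n, n]`:
`(2n+1)(t - t') = a' - a ∈ [-2n, 2n]` forces `t = t'`, hence `a = a'`. [folklore] -/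
theorem offset_inj_coord (n : ℕ) (t t' a a' : ℤ) (ht : 0 ≤ t ∧ t ≤ 2) (ht' : 0 ≤ t' ∧ t' ≤ 2)
    (ha : -(n : ℤ) ≤ a ∧ a ≤ n) (ha' : -(n : ℤ) ≤ a' ∧ a' ≤ n)
    (h : a + (2 * (n : ℤ) + 1) * (t - 1) = a' + (2 * (n : ℤ) + 1) * (t' - 1)) :
    t = t' ∧ a = a' := by
  obtain ⟨ht0, ht2⟩ := ht
  obtain ⟨ht0', ht2'⟩ := ht'
  interval_cases t <;> interval_cases t' <;> omega

/-- The 27 translates `c_v + B(n)`, `c_v = (2n+1)(v - 1)`, `v ∈ {0,1,2}³`, lie in `B(3n+1)`. [folklore] -/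
theorem add_offset_mem_box (n : ℕ) :
    ∀ (v : Fin 3 → Fin 3), ∀ x ∈ box 3 n,
      (x + fun i => (2 * (n : ℤ) + 1) * (((v i : ℕ) : ℤ) - 1)) ∈ box 3 (3 * n + 1) := by
  intro v x hx
  rw [mem_box] at hx ⊢
  intro i
  obtain ⟨h1, h2⟩ := hx i
  have hv3 := (v i).isLt
  obtain ⟨h3, h4⟩ := offset_bounds n (((v i : ℕ) : ℤ)) (by omega) (by omega)
  simp only [Pi.add_apply]
  constructor <;> omega

/-- `(v, x) ↦ x + c_v`, `c_v = (2n+1)(v - 1)`, is injective on `{0,1,2}³ × B(n)` (the 27 translates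
of `B(n)` are pairwise disjoint). [folklore] -/
theorem add_offset_injOn (n : ℕ) :
    Set.InjOn (fun q : (Fin 3 → Fin 3) × Site 3 =>
        q.2 + fun i => (2 * (n : ℤ) + 1) * (((q.1 i : ℕ) : ℤ) - 1))
      (↑((Finset.univ : Finset (Fin 3 → Fin 3)) ×ˢ box 3 n) : Set ((Fin 3 → Fin 3) × Site 3)) := by
  rintro ⟨v, x⟩ hq ⟨v', x'⟩ hq' h
  simp only [Finset.mem_coe, Finset.mem_product, Finset.mem_univ, true_and, mem_box] at hq hq'
  have h' : ∀ i, x i + (2 * (n : ℤ) + 1) * (((v i : ℕ) : ℤ) - 1) =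
      x' i + (2 * (n : ℤ) + 1) * (((v' i : ℕ) : ℤ) - 1) := fun i => by
    simpa only [Pi.add_apply] using congr_fun h i
  have key : ∀ i, v i = v' i ∧ x i = x' i := fun i => by
    have hv3 := (v i).isLt
    have hv3' := (v' i).isLt
    obtain ⟨ht, hxi⟩ := offset_inj_coord n ((v i : ℕ) : ℤ) ((v' i : ℕ) : ℤ) (x i) (x' i)
      ⟨by omega, by omega⟩ ⟨by omega, by omega⟩ (hq i) (hq' i) (h' i)
    exact ⟨Fin.ext (by omega), hxi⟩
  exact Prod.ext (funext fun i => (key i).1) (funext fun i => (key i).2)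

end SubBoxesSuperadditive

open SubBoxesSuperadditive

/-- **stub_subBoxesSuperadditive (A0b, `CROSS ≥ 0`; every `p`; line `Sketch` of crux
`FreeBoxPowerSaving`).**  With `c_v = (2n+1)(v-1)`, `v ∈ {0,1,2}³`: the 27 sets `c_v + B(n)` are
pairwise disjoint subsets of `B(3n+1)` (coordinatewise: `[-3n-1,-n-1] ∪ [-n,n] ∪ [n+1,3n+1]`),
`{x+c_v ↔ y+c_v in c_v+B(n)} ⊆ {x+c_v ↔ y+c_v in B(3n+1)}` (`openConnIn_mono`), and the map
`(v,x) ↦ x + c_v` is injective into `B(3n+1)`, so the triple sum is a sub-sum of the (non-negative)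
big-box pair sum (`sum_translates_le` with `add_offset_mem_box`, `add_offset_injOn`;
Grimmett 1999, §1.6). [folklore] -/
theorem stub_subBoxesSuperadditive :
    ∀ (p : unitInterval) (n : ℕ),
      (∑ v : Fin 3 → Fin 3, ∑ x ∈ box 3 n, ∑ y ∈ box 3 n,
        (bondPercolation (zdGraph 3) p).real
          (openConnIn
            ((fun w : Site 3 => w + fun i => (2 * (n : ℤ) + 1) * (((v i : ℕ) : ℤ) - 1)) ''
              (↑(box 3 n) : Set (Site 3)))
            (x + fun i => (2 * (n : ℤ) + 1) * (((v i : ℕ) : ℤ) - 1))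
            (y + fun i => (2 * (n : ℤ) + 1) * (((v i : ℕ) : ℤ) - 1)))) ≤
      ∑ x ∈ box 3 (3 * n + 1), ∑ y ∈ box 3 (3 * n + 1),
        (bondPercolation (zdGraph 3) p).real (openConnIn (↑(box 3 (3 * n + 1)) : Set (Site 3)) x y) :=
  fun p n =>
    sum_translates_le (bondPercolation (zdGraph 3) p)
      (fun (v : Fin 3 → Fin 3) (i : Fin 3) => (2 * (n : ℤ) + 1) * (((v i : ℕ) : ℤ) - 1))
      (add_offset_mem_box n) (add_offset_injOn n)

end Summit.CriticalPhenomena.PercolationContinuityZ3.FreeBoxPowerSavingLine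

end
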